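import Summits.AtomisticToContinuum.BoseEinsteinCondensation.Theses.BECRieszShadow

/-!
# Route `BECRieszShadow` — typed split of the deciding crux `PalmAffinityBound`

Strategist decomposition (bc2 redirect) of the deciding crux
`Summit.AtomisticToContinuum.BoseEinsteinCondensation.Theses.BECRieszShadow.PalmAffinityBound`
(stmt-AtomisticToContinuum-9157) into the route's two existing branch cruxes

* `TeleportEntropyBound` (stmt-AtomisticToContinuum-9158, bounded potentials, entropy currency), and
* `HardCorePalmAffinity` (stmt-AtomisticToContinuum-10241, unbounded potentials / hard cores),

with the assembly `PalmAffinityBound_of_subs : TeleportEntropyBound → HardCorePalmAffinity →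
PalmAffinityBound` PROVED here (this is also the exact type of the support item `AffinityOfEntropy`,
stmt-AtomisticToContinuum-14579). The seam is not bookkeeping: on the bounded branch it is the
PALM–JENSEN inequality (the content of support item `PalmJensen`, stmt-AtomisticToContinuum-9162,
proved below in the elementary pointwise form that needs neither convexity of `exp` nor the
equal-slice-mass hypothesis):

  for `a, b > 0`:  `e^{-K/2} · a² (1 + K/2 + log (b/a)) ≤ a b`   (from `1 + t ≤ eᵗ`),

integrated over the bath cell `cell^n` with `a = |Ψ(x,Y)|`, `b = |Ψ(y,Y)|` and combined with the
relative-entropy hypothesis `∫ a² log(a²/b²) ≤ K ∫ a²` to give `e^{-K/2} ∫ a² ≤ ∫ a b`, followed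
by the Bochner → `lintegral` conversion of both sides (`C ↦ C/2`). The unbounded branch is
`HardCorePalmAffinity` verbatim (case split on `∃ M, ∀ r, v r ≤ M`).

References: Reatto1969 (Jensen bound for ODLRO from the pair-entropy), PenroseOnsager1956, LSSY2005.
-/

namespace Summit.AtomisticToContinuum.BoseEinsteinCondensation.Theorems

open MeasureTheory Filter
open scoped ENNReal NNReal
open Literature.MathematicalPhysics.QuantumManyBody.BoseGas
open Summit.AtomisticToContinuum.BoseEinsteinCondensation.Theses.BECRieszShadow

/-- **Pointwise Palm–Jensen.** For `a, b > 0` and any `K`,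
`e^{-K/2} (a² + (K/2) a² - ½ a² log(a²/b²)) ≤ a b`; i.e. `a²(1 + t) ≤ a² eᵗ` with
`t = log(b/a) + K/2`. [folklore] -/
theorem palmJensen_pointwise {a b : ℝ} (ha : 0 < a) (hb : 0 < b) (K : ℝ) :
    Real.exp (-(K / 2)) * (a ^ 2 + K / 2 * a ^ 2 - 1 / 2 * (a ^ 2 * Real.log (a ^ 2 / b ^ 2)))
      ≤ a * b := by
  have ha' : a ≠ 0 := ha.ne'
  have hb' : b ≠ 0 := hb.ne'
  have hlog : Real.log (a ^ 2 / b ^ 2) = 2 * Real.log a - 2 * Real.log b := by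
    rw [Real.log_div (pow_ne_zero _ ha') (pow_ne_zero _ hb'), Real.log_pow, Real.log_pow]
    push_cast
    ring
  have hba : Real.log (b / a) = Real.log b - Real.log a := Real.log_div hb' ha'
  have h1 : Real.log (b / a) + K / 2 + 1 ≤ Real.exp (Real.log (b / a) + K / 2) :=
    Real.add_one_le_exp _
  have hexp : Real.exp (Real.log (b / a) + K / 2) = b / a * Real.exp (K / 2) := by
    rw [Real.exp_add, Real.exp_log (div_pos hb ha)]
  have hid : a ^ 2 + K / 2 * a ^ 2 - 1 / 2 * (a ^ 2 * Real.log (a ^ 2 / b ^ 2))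
      = a ^ 2 * (Real.log (b / a) + K / 2 + 1) := by
    rw [hlog, hba]; ring
  rw [hid]
  have h2 : a ^ 2 * (Real.log (b / a) + K / 2 + 1) ≤ a ^ 2 * (b / a * Real.exp (K / 2)) :=
    mul_le_mul_of_nonneg_left (h1.trans_eq hexp) (sq_nonneg a)
  have h3 : a ^ 2 * (b / a * Real.exp (K / 2)) = a * b * Real.exp (K / 2) := by
    field_simp
  calc Real.exp (-(K / 2)) * (a ^ 2 * (Real.log (b / a) + K / 2 + 1))
      ≤ Real.exp (-(K / 2)) * (a ^ 2 * (b / a * Real.exp (K / 2))) :=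
        mul_le_mul_of_nonneg_left h2 (Real.exp_pos _).le
    _ = a * b * (Real.exp (-(K / 2)) * Real.exp (K / 2)) := by rw [h3]; ring
    _ = a * b := by rw [← Real.exp_add, neg_add_cancel, Real.exp_zero, mul_one]

/-- **Palm–Jensen on the bath cell** (relative-entropy ⇒ affinity). For continuous, strictly
positive `f, g` on `n`-particle configurations with
`∫_{cell^n} f² log(f²/g²) ≤ K ∫_{cell^n} f²`, one has `e^{-K/2} ∫_{cell^n} f² ≤ ∫_{cell^n} f g`.
(Jensen for `exp` under the Palm law `f²/∫f²`; here from the pointwise bound.) [cite: Reatto1969] -/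
theorem palmJensen_integral {n : ℕ} (L K : ℝ) {f g : Config n → ℝ} (hf : Continuous f)
    (hg : Continuous g) (hfpos : ∀ Y, 0 < f Y) (hgpos : ∀ Y, 0 < g Y)
    (hKL : ∫ Y in cellN n L, f Y ^ 2 * Real.log (f Y ^ 2 / g Y ^ 2) ≤ K * ∫ Y in cellN n L, f Y ^ 2) :
    Real.exp (-(K / 2)) * ∫ Y in cellN n L, f Y ^ 2 ≤ ∫ Y in cellN n L, f Y * g Y := by
  have hquot : Continuous fun Y => f Y ^ 2 / g Y ^ 2 :=
    (hf.pow 2).div (hg.pow 2) fun Y => pow_ne_zero _ (hgpos Y).ne'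
  have hlogc : Continuous fun Y => Real.log (f Y ^ 2 / g Y ^ 2) :=
    hquot.log fun Y => (div_pos (pow_pos (hfpos Y) 2) (pow_pos (hgpos Y) 2)).ne'
  have hcont : Continuous fun Y => f Y ^ 2 * Real.log (f Y ^ 2 / g Y ^ 2) := (hf.pow 2).mul hlogc
  have hi1 : IntegrableOn (fun Y => f Y ^ 2) (cellN n L) := integrableOn_cellN (hf.pow 2) L
  have hi2 : IntegrableOn (fun Y => f Y ^ 2 * Real.log (f Y ^ 2 / g Y ^ 2)) (cellN n L) :=
    integrableOn_cellN hcont L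
  have hi3 : IntegrableOn (fun Y => f Y * g Y) (cellN n L) := integrableOn_cellN (hf.mul hg) L
  have hi4 : IntegrableOn (fun Y => K / 2 * f Y ^ 2) (cellN n L) := hi1.const_mul (K / 2)
  have hi5 : IntegrableOn (fun Y => 1 / 2 * (f Y ^ 2 * Real.log (f Y ^ 2 / g Y ^ 2))) (cellN n L) :=
    hi2.const_mul (1 / 2)
  have hi14 : IntegrableOn (fun Y => f Y ^ 2 + K / 2 * f Y ^ 2) (cellN n L) := hi1.add hi4
  have hi6 : IntegrableOn
      (fun Y => f Y ^ 2 + K / 2 * f Y ^ 2 - 1 / 2 * (f Y ^ 2 * Real.log (f Y ^ 2 / g Y ^ 2)))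
      (cellN n L) := hi14.sub hi5
  have hi7 : IntegrableOn (fun Y => Real.exp (-(K / 2)) *
      (f Y ^ 2 + K / 2 * f Y ^ 2 - 1 / 2 * (f Y ^ 2 * Real.log (f Y ^ 2 / g Y ^ 2)))) (cellN n L) :=
    hi6.const_mul _
  -- integrate the pointwise inequality
  have hint : ∫ Y in cellN n L, Real.exp (-(K / 2)) *
        (f Y ^ 2 + K / 2 * f Y ^ 2 - 1 / 2 * (f Y ^ 2 * Real.log (f Y ^ 2 / g Y ^ 2)))
      ≤ ∫ Y in cellN n L, f Y * g Y :=
    integral_mono hi7 hi3 fun Y => palmJensen_pointwise (hfpos Y) (hgpos Y) K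
  -- evaluate the left-hand side
  have hlhs : ∫ Y in cellN n L, Real.exp (-(K / 2)) *
        (f Y ^ 2 + K / 2 * f Y ^ 2 - 1 / 2 * (f Y ^ 2 * Real.log (f Y ^ 2 / g Y ^ 2)))
      = Real.exp (-(K / 2)) * ((∫ Y in cellN n L, f Y ^ 2) + K / 2 * (∫ Y in cellN n L, f Y ^ 2)
          - 1 / 2 * ∫ Y in cellN n L, f Y ^ 2 * Real.log (f Y ^ 2 / g Y ^ 2)) := by
    rw [integral_const_mul, integral_sub hi14 hi5, integral_add hi1 hi4,
      integral_const_mul, integral_const_mul]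
  have hmono : Real.exp (-(K / 2)) * ∫ Y in cellN n L, f Y ^ 2
      ≤ Real.exp (-(K / 2)) * ((∫ Y in cellN n L, f Y ^ 2) + K / 2 * (∫ Y in cellN n L, f Y ^ 2)
          - 1 / 2 * ∫ Y in cellN n L, f Y ^ 2 * Real.log (f Y ^ 2 / g Y ^ 2)) :=
    mul_le_mul_of_nonneg_left (by linarith) (Real.exp_pos _).le
  exact hmono.trans (hlhs.symm.le.trans hint)

/-- `(‖z‖₊ : ℝ≥0∞) = ofReal ‖z‖`. [folklore] -/
theorem coe_nnnorm_eq_ofReal_norm' (z : ℂ) : ((‖z‖₊ : ℝ≥0∞)) = ENNReal.ofReal ‖z‖ := by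
  rw [← coe_nnnorm, ENNReal.ofReal_coe_nnreal]

/-- **Typed split of the deciding crux** (strategist, bc2 redirect):
`TeleportEntropyBound → HardCorePalmAffinity → PalmAffinityBound`.
Bounded `v`: the strictly positive near-minimiser of `TeleportEntropyBound` with Palm relative
entropy `≤ C` has Palm affinity `≥ e^{-C/2}` by `palmJensen_integral`; unbounded `v`:
`HardCorePalmAffinity` verbatim. [cite: Reatto1969] [cite: PenroseOnsager1956] [cite: LSSY2005, Ch. 5] -/
theorem PalmAffinityBound_of_subs (hTE : TeleportEntropyBound) (hH : HardCorePalmAffinity) :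
    PalmAffinityBound := by
  intro v hv
  by_cases hb : ∃ M : NNReal, ∀ r, v r ≤ M
  · obtain ⟨ρ₀, hρ₀, hρ⟩ := hTE v hv hb
    refine ⟨ρ₀, hρ₀, fun ρ hρpos hρlt => ?_⟩
    obtain ⟨C, hC⟩ := hρ ρ hρpos hρlt
    refine ⟨C / 2, ?_⟩
    filter_upwards [hC] with n hn δ hδ
    obtain ⟨Ψ, hE, hpos, _hmass, hKL⟩ := hn δ hδ
    refine ⟨Ψ, hE, fun X => ?_, fun x y => ?_⟩
    · obtain ⟨hre, him⟩ := hpos X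
      have hX : Ψ.ψ X = ((Ψ.ψ X).re : ℂ) := Complex.ext (by simp) (by simp [him])
      rw [hX, Complex.norm_real, Real.norm_of_nonneg hre.le]
    · have hΨc : Continuous Ψ.ψ := Ψ.contDiff.continuous
      have hsx : Continuous fun Y : Config n => Ψ.ψ (Matrix.vecCons x Y) :=
        hΨc.comp (continuous_const.matrixVecCons continuous_id)
      have hsy : Continuous fun Y : Config n => Ψ.ψ (Matrix.vecCons y Y) :=
        hΨc.comp (continuous_const.matrixVecCons continuous_id)
      have hne : ∀ X, Ψ.ψ X ≠ 0 := fun X h0 => by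
        have h := (hpos X).1
        rw [h0, Complex.zero_re] at h
        exact lt_irrefl 0 h
      have hfpos : ∀ Y : Config n, 0 < ‖Ψ.ψ (Matrix.vecCons x Y)‖ := fun Y => norm_pos_iff.2 (hne _)
      have hgpos : ∀ Y : Config n, 0 < ‖Ψ.ψ (Matrix.vecCons y Y)‖ := fun Y => norm_pos_iff.2 (hne _)
      -- Palm–Jensen with K := C
      have key : Real.exp (-(C / 2)) * ∫ Y in cellN n (sideLength ρ (n + 1)), ‖Ψ.ψ (Matrix.vecCons x Y)‖ ^ 2
          ≤ ∫ Y in cellN n (sideLength ρ (n + 1)),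
              ‖Ψ.ψ (Matrix.vecCons x Y)‖ * ‖Ψ.ψ (Matrix.vecCons y Y)‖ :=
        palmJensen_integral (f := fun Y => ‖Ψ.ψ (Matrix.vecCons x Y)‖)
          (g := fun Y => ‖Ψ.ψ (Matrix.vecCons y Y)‖) (sideLength ρ (n + 1)) C hsx.norm hsy.norm
          hfpos hgpos (hKL x y)
      have key' : ∫ Y in cellN n (sideLength ρ (n + 1)), ‖Ψ.ψ (Matrix.vecCons x Y)‖ ^ 2
          ≤ Real.exp (C / 2) * ∫ Y in cellN n (sideLength ρ (n + 1)),
              ‖Ψ.ψ (Matrix.vecCons x Y)‖ * ‖Ψ.ψ (Matrix.vecCons y Y)‖ := by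
        have hmul := mul_le_mul_of_nonneg_left key (Real.exp_pos (C / 2)).le
        rwa [← mul_assoc, ← Real.exp_add, add_neg_cancel, Real.exp_zero, one_mul] at hmul
      -- Bochner → lintegral
      have h1 : ∫⁻ Y in cellN n (sideLength ρ (n + 1)), (‖Ψ.ψ (Matrix.vecCons x Y)‖₊ : ℝ≥0∞) ^ 2
          = ENNReal.ofReal (∫ Y in cellN n (sideLength ρ (n + 1)), ‖Ψ.ψ (Matrix.vecCons x Y)‖ ^ 2) :=
        lintegral_cellN_nnnorm_sq_eq_ofReal (sideLength ρ (n + 1)) hsx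
      have h2 : ∫⁻ Y in cellN n (sideLength ρ (n + 1)),
            (‖Ψ.ψ (Matrix.vecCons x Y)‖₊ : ℝ≥0∞) * (‖Ψ.ψ (Matrix.vecCons y Y)‖₊ : ℝ≥0∞)
          = ENNReal.ofReal (∫ Y in cellN n (sideLength ρ (n + 1)),
              ‖Ψ.ψ (Matrix.vecCons x Y)‖ * ‖Ψ.ψ (Matrix.vecCons y Y)‖) := by
        have hi : IntegrableOn (fun Y : Config n =>
            ‖Ψ.ψ (Matrix.vecCons x Y)‖ * ‖Ψ.ψ (Matrix.vecCons y Y)‖) (cellN n (sideLength ρ (n + 1))) :=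
          integrableOn_cellN (hsx.norm.mul hsy.norm) _
        rw [ofReal_integral_eq_lintegral_ofReal hi
          (ae_of_all _ fun Y => mul_nonneg (norm_nonneg _) (norm_nonneg _))]
        refine lintegral_congr fun Y => ?_
        rw [ENNReal.ofReal_mul (norm_nonneg _), coe_nnnorm_eq_ofReal_norm',
          coe_nnnorm_eq_ofReal_norm']
      rw [h1, h2, ← ENNReal.ofReal_mul (Real.exp_pos _).le]
      exact ENNReal.ofReal_le_ofReal key'
  · exact hH v hv hb

end Summit.AtomisticToContinuum.BoseEinsteinCondensation.Theorems
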